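import Summits.Parity.GeneralizedHardyLittlewood.Theses.LeeYangFibres
import Literature.NumberTheory.Sieve.LinearEquationsInPrimesMainReduction
import HarnessLib

/-!
# Route `LeeYangFibres`, item `AbsoluteUpgrade` (stmt-Parity-14116): the provable slices

`AbsoluteUpgrade := RelativeDimOne → DimOne` upgrades the RELATIVE accuracy
`ε · (β_∞ ∏_p β_p + N)` of Green–Tao's Conjecture 1.4 error shape to the ABSOLUTE accuracy `ε N` of
Conjecture 1.2 (`DimOne`, the `d = 1` case of `GeneralizedHardyLittlewood`).  The two shapes differ
exactly on the pairs `(Ψ, K)` whose *singular mass* `β_∞ ∏_p β_p = archFactor Ψ K * singularProduct Ψ`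
is large compared with `N`; since `β_∞ ≤ 2N` (`archFactor_le_two_mul`), this means systems with a
large singular product, which at `d = 1`, `t ≥ 2` (infinite complexity: all linear parts parallel)
is unbounded in `N` (pair systems `(n, n + h)` with `h ∣ primorial`, `∏_p β_p ≍ log log N`).

This file records what IS provable now, as support for the item:

* `archFactor_le_two_mul` — `β_∞(Ψ, K) ≤ 2N` for `K ⊆ [-N, N]`;
* `dimOne_bound_of_mass_le` — `RelativeDimOne` gives the absolute bound `ε N` on every admissible
  pair with singular mass `≤ M N` (any `t`);
* `dimOne_one_of_relativeDimOne` — the **`t = 1` slice** of the upgrade: a single form has finite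
  complexity, so `0 ≤ ∏_p β_p ≤ B(L)` uniformly
  (`Literature.NumberTheory.Sieve.singularProduct_mem_Icc_uniform`, Green–Tao Lemma 1.3), hence
  singular mass `≤ 2 B N`;
* `absoluteUpgrade_iff_highMass` — **the item is equivalent to its residual core**: given
  `RelativeDimOne`, it suffices (and is necessary) to treat, for `t ≥ 2`, the pairs with singular
  mass `≥ M N` for some `M = M(t, L, ε)`.  (Trivially the item is implied by its conclusion
  `DimOne`, the shared target stmt-Parity-0819; no mechanism of the route addresses the core.)

References: B. Green, T. Tao, *Linear equations in primes*, Ann. of Math. 171 (2010), Conj. 1.2,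
Lemma 1.3, Conj. 1.4 and the remark after Lemma 1.6 (bounded singular series in finite complexity).
-/

noncomputable section

namespace Summit.Parity.GeneralizedHardyLittlewood.Theorems.AbsoluteUpgrade

open MeasureTheory Literature.NumberTheory.Sieve
open Summit.Parity.GeneralizedHardyLittlewood.Theses.LeeYangFibres (RelativeDimOne AbsoluteUpgrade)

/-- The archimedean factor of a body inside the box `[-N, N]` (dimension `1`) is at most the
length of the box: `β_∞(Ψ, K) = vol (K ∩ {Ψ > 0}) ≤ vol [-N, N] = 2N`. -/
theorem archFactor_le_two_mul {t : ℕ} (Ψ : Fin t → AffLinForm 1) {K : Set (Fin 1 → ℝ)} {N : ℕ}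
    (hK : K ⊆ realBox 1 N) : archFactor Ψ K ≤ 2 * (N : ℝ) := by
  have hle : (fun _ : Fin 1 => -(N : ℝ)) ≤ fun _ => (N : ℝ) := fun _ => by
    simp only
    linarith [(Nat.cast_nonneg N : (0 : ℝ) ≤ N)]
  have hvol : (volume (realBox 1 (N : ℝ))).toReal = 2 * (N : ℝ) := by
    unfold realBox
    rw [Real.volume_Icc_pi_toReal hle, Fin.prod_univ_one]
    ring
  have hsub : K ∩ {x | ∀ i, 0 < (Ψ i).realEval x} ⊆ realBox 1 (N : ℝ) := fun x hx => hK hx.1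
  have htop : volume (realBox 1 (N : ℝ)) ≠ ⊤ := by
    unfold realBox
    rw [Real.volume_Icc_pi]
    exact ENNReal.prod_ne_top fun _ _ => ENNReal.ofReal_ne_top
  rw [← hvol]
  exact ENNReal.toReal_mono htop (measure_mono hsub)

/-- **Bounded singular mass.** `RelativeDimOne` already gives the absolute error `ε N` of `DimOne`
on every admissible pair `(Ψ, K)` whose singular mass `archFactor Ψ K * singularProduct Ψ` is at
most `M N`: apply it with `ε / (M + 1)`. (Any number of forms `t`.) -/
theorem dimOne_bound_of_mass_le (h : RelativeDimOne) (t L : ℕ) (ht : 1 ≤ t) {M ε : ℝ}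
    (hM : 0 ≤ M) (hε : 0 < ε) :
    ∃ N₀ : ℕ, ∀ N : ℕ, N₀ ≤ N → ∀ Ψ : Fin t → AffLinForm 1, IsNondegenerateSystem Ψ →
      affLinSize Ψ N ≤ L → ∀ K : Set (Fin 1 → ℝ), Convex ℝ K → K ⊆ realBox 1 N →
        archFactor Ψ K * singularProduct Ψ ≤ M * N →
          |vonMangoldtSum Ψ K N - archFactor Ψ K * singularProduct Ψ| ≤ ε * (N : ℝ) := by
  obtain ⟨N₀, hN₀⟩ := h t L ht (ε / (M + 1)) (by positivity)
  refine ⟨N₀, fun N hN Ψ hΨ hL K hK hKN hmass => ?_⟩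
  calc |vonMangoldtSum Ψ K N - archFactor Ψ K * singularProduct Ψ|
      ≤ ε / (M + 1) * (archFactor Ψ K * singularProduct Ψ + N) := hN₀ N hN Ψ hΨ hL K hK hKN
    _ ≤ ε / (M + 1) * (M * N + N) := by gcongr
    _ = ε * (N : ℝ) := by
        field_simp

/-- A system consisting of a single form has finite complexity (there is no pair `i ≠ j`). -/
theorem isFiniteComplexitySystem_of_subsingleton {d : ℕ} (Ψ : Fin 1 → AffLinForm d) :
    IsFiniteComplexitySystem Ψ :=
  fun i j hij => absurd (Subsingleton.elim i j) hij

/-- **The `t = 1` slice of `AbsoluteUpgrade`.** For one form `ψ(n) = a n + b` (`1 ≤ |a| ≤ L`) the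
singular product is `|a|/φ(|a|)` or `0`, in any case `0 ≤ ∏_p β_p ≤ B(L)` uniformly
(`singularProduct_mem_Icc_uniform`: a single form has finite complexity), and `β_∞ ≤ 2N`; so the
singular mass is `≤ 2 B N` and `dimOne_bound_of_mass_le` applies: `RelativeDimOne` implies the
`t = 1` case of `DimOne`. -/
theorem dimOne_one_of_relativeDimOne (h : RelativeDimOne) (L : ℕ) (ε : ℝ) (hε : 0 < ε) :
    ∃ N₀ : ℕ, ∀ N : ℕ, N₀ ≤ N → ∀ Ψ : Fin 1 → AffLinForm 1, IsNondegenerateSystem Ψ →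
      affLinSize Ψ N ≤ L → ∀ K : Set (Fin 1 → ℝ), Convex ℝ K → K ⊆ realBox 1 N →
        |vonMangoldtSum Ψ K N - archFactor Ψ K * singularProduct Ψ| ≤ ε * (N : ℝ) := by
  obtain ⟨B, hB0, hB⟩ := singularProduct_mem_Icc_uniform 1 L
  obtain ⟨N₀, hN₀⟩ := dimOne_bound_of_mass_le h 1 L le_rfl (M := 2 * B) (by positivity) hε
  refine ⟨N₀, fun N hN Ψ hΨ hL K hK hKN => hN₀ N hN Ψ hΨ hL K hK hKN ?_⟩
  obtain ⟨hS0, hSB⟩ := hB 1 Ψ hΨ (isFiniteComplexitySystem_of_subsingleton Ψ)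
    (natAbs_coeff_le_of_affLinSize_le hL)
  calc archFactor Ψ K * singularProduct Ψ ≤ (2 * (N : ℝ)) * B :=
        mul_le_mul (archFactor_le_two_mul Ψ hKN) hSB hS0 (by positivity)
    _ = 2 * B * N := by ring

/-- **`AbsoluteUpgrade` is equivalent to its residual core.** Given `RelativeDimOne`, the item
holds if and only if, for every `t ≥ 2`, `L` and `ε > 0`, there is a threshold `M` such that the
absolute bound `ε N` holds eventually on all admissible pairs `(Ψ, K)` carrying singular mass
`archFactor Ψ K * singularProduct Ψ ≥ M N` (the systems with `∏_p β_p ≫ 1`, e.g. shifts with many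
small prime factors).  `→`: `DimOne` gives it with `M = 0`.  `←`: the case `t = 1` is
`dimOne_one_of_relativeDimOne` and the pairs of mass `≤ M N` are `dimOne_bound_of_mass_le`. -/
theorem absoluteUpgrade_iff_highMass :
    AbsoluteUpgrade ↔ (RelativeDimOne → ∀ (t L : ℕ), 2 ≤ t → ∀ ε : ℝ, 0 < ε → ∃ M : ℝ, 0 ≤ M ∧
      ∃ N₀ : ℕ, ∀ N : ℕ, N₀ ≤ N → ∀ Ψ : Fin t → AffLinForm 1, IsNondegenerateSystem Ψ →
        affLinSize Ψ N ≤ L → ∀ K : Set (Fin 1 → ℝ), Convex ℝ K → K ⊆ realBox 1 N →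
          M * N ≤ archFactor Ψ K * singularProduct Ψ →
            |vonMangoldtSum Ψ K N - archFactor Ψ K * singularProduct Ψ| ≤ ε * (N : ℝ)) := by
  constructor
  · intro hU hR t L ht2 ε hε
    obtain ⟨N₀, hN₀⟩ := hU hR t L (by omega) ε hε
    exact ⟨0, le_rfl, N₀, fun N hN Ψ hΨ hL K hK hKN _ => hN₀ N hN Ψ hΨ hL K hK hKN⟩
  · intro hhigh hR t L ht ε hε
    rcases ht.eq_or_lt with rfl | ht2
    · exact dimOne_one_of_relativeDimOne hR L ε hε
    · obtain ⟨M, hM0, N₁, hN₁⟩ := hhigh hR t L ht2 ε hε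
      obtain ⟨N₂, hN₂⟩ := dimOne_bound_of_mass_le hR t L ht hM0 hε
      refine ⟨max N₁ N₂, fun N hN Ψ hΨ hL K hK hKN => ?_⟩
      rcases le_total (archFactor Ψ K * singularProduct Ψ) (M * N) with hlow | hbig
      · exact hN₂ N (le_of_max_le_right hN) Ψ hΨ hL K hK hKN hlow
      · exact hN₁ N (le_of_max_le_left hN) Ψ hΨ hL K hK hKN hbig

end Summit.Parity.GeneralizedHardyLittlewood.Theorems.AbsoluteUpgrade

end
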